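import Summits.FinalStateConjecture.FinalStateConjecture.Theorems.ZeroEnergyKerrOrBombHawkingExtensionIsKerrLocalZerothLawCodazzi
import Literature.Geometry.Lorentzian.LeviCivitaProofs
import HarnessLib

/-!
# Crux `HawkingExtensionIsKerr` (stmt-FinalStateConjecture-17840), line `SketchIdeator2` —
# programme NH, brick NH4: the horizon is totally geodesic along its Killing normal

Abstract setting: a `C^∞` pseudo-Riemannian manifold with a global Killing field `K`, a point `p`,
and a real function `F`, smooth near `p`, with `F p = 0`, `dF_p = c g(K_p, ·)` (`c ≠ 0`,
`K_p ≠ 0`) and, near `p`, `dF_x = c'(x) g(K_x, ·)` with `c'(x) ≠ 0` at the points of `{F = 0}`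
(the smooth local defining function of the horizon supplied by programme HR).  Then the null
hypersurface `{F = 0}` is totally geodesic along `K` at `p`:
`B(X, Z) = g(∇_X K, Z) = 0` for all `X, Z ∈ ker dF_p = K_p^⊥` (`nh_secondFF_eq_zero`).

Proof (Hessian symmetric versus Killing antisymmetric).  Every `X ∈ ker dF_p` extends to a field
`Xt`, smooth at `p`, tangent to all level sets of `F` near `p` (`exists_tangent_extension_fun`,
the analogue of `exists_tangent_extension` of `…LocalZerothLawCodazzi` for a general `F`).  The
function `g(K, Zt)` vanishes on `{F = 0}` near `p`, so its differential kills `ker dF_p`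
(`mvfderiv_apply_eq_zero_of_levelSet`, step C of c3); metric compatibility gives
`g(∇_X K, Z) + g(K, ∇_X Zt) = 0` (`★1`) and symmetrically `g(∇_Z K, X) + g(K, ∇_Z Xt) = 0` (`★2`).
Since `dF(Zt) ≡ 0` near `p`, `Hess F (X, Z) = X(Zt F) - dF(∇_X Zt) = -c g(K, ∇_X Zt)`
(`hessian_apply_holds`), and the symmetry of the Hessian (`hessian_symm_holds`) gives
`g(K, ∇_X Zt) = g(K, ∇_Z Xt)`; with `★1`, `★2`: `g(∇_X K, Z) = g(∇_Z K, X)`, while the Killing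
equation says `g(∇_X K, Z) = -g(∇_Z K, X)`.  Reference: Wald 1984, §12.5 (vanishing of expansion
and shear of the generators of a Killing horizon); O'Neill 1983, Ch. 3, Def. 3.48–Lemma 3.49.
-/

noncomputable section

set_option linter.dupNamespace false

namespace Summit.FinalStateConjecture.FinalStateConjecture.Theorems.HawkingExtensionIsKerr.SketchIdeator2

open Set Filter Bundle Function FiberBundle Literature.Geometry.Lorentzian
open scoped Manifold ContDiff Topology

section NHSecondFF

variable {E : Type*} [NormedAddCommGroup E] [NormedSpace ℝ E] [FiniteDimensional ℝ E]
  [CompleteSpace E] {H : Type*} [TopologicalSpace H] {I : ModelWithCorners ℝ E H}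
  [I.Boundaryless] {M : Type*} [TopologicalSpace M] [ChartedSpace H M] [IsManifold I ∞ M]
  {g : PseudoRiemannianMetric I ∞ E (TangentSpace I : M → Type _)} [g.HasLeviCivita]
  {K : Π x : M, TangentSpace I x}

omit [FiniteDimensional ℝ E] [CompleteSpace E] [I.Boundaryless] in
/-- **Tangent extensions along the level sets of a function.**  For `F` smooth at `x` with
`dF_x ≠ 0`, every `X ∈ ker dF_x` extends to a vector field `Xt`, smooth at `x`, with `Xt x = X`
and `dF(Xt) = 0` identically near `x`: `Xt = X̂ - (dF(X̂)/dF(V)) V` for the canonical extensions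
`X̂`, `V` of `X` and of a vector `v₀` with `dF_x(v₀) ≠ 0` (cf. `exists_tangent_extension`). -/
theorem exists_tangent_extension_fun {F : M → ℝ} {x : M} (hF : ContMDiffAt I 𝓘(ℝ, ℝ) ∞ F x)
    (hdF : mvfderiv I F x ≠ 0) {X : TangentSpace I x} (hX : mvfderiv I F x X = 0) :
    ∃ Xt : Π y : M, TangentSpace I y, CMDiffAt ∞ (T% Xt) x ∧ Xt x = X ∧
      ∀ᶠ y in 𝓝 x, mvfderiv I F y (Xt y) = 0 := by
  -- a vector `v₀` with `dF_x(v₀) ≠ 0`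
  obtain ⟨v₀, hv₀⟩ : ∃ v₀, mvfderiv I F x v₀ ≠ 0 := by
    by_contra h
    push Not at h
    exact hdF (ContinuousLinearMap.ext fun v ↦ by rw [h v]; rfl)
  set V : Π y : M, TangentSpace I y := FiberBundle.extend E v₀ with hVdef
  set Xh : Π y : M, TangentSpace I y := FiberBundle.extend E X with hXhdef
  have hV : CMDiffAt ∞ (T% V) x := contMDiffAt_extend ..
  have hXh : CMDiffAt ∞ (T% Xh) x := contMDiffAt_extend ..
  have hVx : V x = v₀ := extend_apply_self E v₀
  have hXhx : Xh x = X := extend_apply_self E X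
  set a : M → ℝ := fun y ↦ mvfderiv I F y (Xh y) with hadef
  set b : M → ℝ := fun y ↦ mvfderiv I F y (V y) with hbdef
  have ha : ContMDiffAt I 𝓘(ℝ, ℝ) ∞ a x :=
    contMDiffAt_mvfderiv_apply_of_le (m := ∞) (hF.of_le le_rfl) hXh
  have hb : ContMDiffAt I 𝓘(ℝ, ℝ) ∞ b x :=
    contMDiffAt_mvfderiv_apply_of_le (m := ∞) (hF.of_le le_rfl) hV
  have hbx : b x ≠ 0 := by
    change mvfderiv I F x (V x) ≠ 0
    rwa [hVx]
  have hax : a x = 0 := by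
    change mvfderiv I F x (Xh x) = 0
    rwa [hXhx]
  set c : M → ℝ := fun y ↦ -(a y / b y) with hcdef
  have hc : ContMDiffAt I 𝓘(ℝ, ℝ) ∞ c x := (ha.div₀ hb hbx).neg
  refine ⟨Xh + c • V, hXh.add_section (hc.smul_section hV), ?_, ?_⟩
  · change Xh x + c x • V x = X
    have hcx : c x = 0 := by
      change -(a x / b x) = 0
      rw [hax, zero_div, neg_zero]
    rw [hcx, zero_smul, add_zero, hXhx]
  · have hbne : ∀ᶠ y in 𝓝 x, b y ≠ 0 := hb.continuousAt.eventually_ne hbx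
    filter_upwards [hbne] with y hy
    have hy' : (Xh + c • V) y = Xh y + c y • V y := rfl
    have hay : mvfderiv I F y (Xh y) = a y := rfl
    have hby : mvfderiv I F y (V y) = b y := rfl
    have hcy : c y = -(a y / b y) := rfl
    rw [hy', map_add, map_smul, hay, hby, hcy, smul_eq_mul]
    field_simp
    ring

/-- **NH4: the null hypersurface `{F = 0}` is totally geodesic along its Killing normal.**  For a
Killing field `K`, a function `F` smooth near `p` with `F p = 0`, `K p ≠ 0`, `dF_p = c g(K_p, ·)`
with `c ≠ 0`, and `dF_x = c'(x) g(K_x, ·)`, `c'(x) ≠ 0`, at the points of `{F = 0}` near `p`: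
`g(∇_X K, Z) = 0` for all `X, Z ∈ ker dF_p` (the Hessian of `F` on `ker dF_p` is
`-c g(K, ∇_X Zt)`, symmetric in `X, Z`, while the Killing equation makes `g(∇_X K, Z)`
antisymmetric; Wald 1984, §12.5). -/
theorem nh_secondFF_eq_zero (hK : g.IsKillingField K) {F : M → ℝ} {p : M} {c : ℝ}
    (hF : ∀ᶠ x in 𝓝 p, ContMDiffAt I 𝓘(ℝ, ℝ) ∞ F x) (hFp : F p = 0) (hKp : K p ≠ 0)
    (hc : c ≠ 0) (hdFp : ∀ w : TangentSpace I p, mvfderiv I F p w = c * g.val p (K p) w)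
    (hdF : ∀ᶠ x in 𝓝 p, F x = 0 → ∃ c' : ℝ, c' ≠ 0 ∧
      ∀ w : TangentSpace I x, mvfderiv I F x w = c' * g.val x (K x) w)
    {X Z : TangentSpace I p} (hX : mvfderiv I F p X = 0) (hZ : mvfderiv I F p Z = 0) :
    g.val p (g.leviCivita K p X) Z = 0 := by
  have hLC : g.IsLeviCivita g.leviCivita := PseudoRiemannianMetric.isLeviCivita_leviCivita_holds
  have hFs : ContMDiffAt I 𝓘(ℝ, ℝ) ∞ F p := hF.self_of_nhds
  have hF2 : ContMDiffAt I 𝓘(ℝ, ℝ) 2 F p := hFs.of_le ENat.LEInfty.out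
  have hF1 : ContMDiffAt I 𝓘(ℝ, ℝ) 1 F p := hFs.of_le ENat.LEInfty.out
  -- (0) `dF_p ≠ 0`
  obtain ⟨u₀, hu₀⟩ : ∃ u₀, g.val p (K p) u₀ ≠ 0 := by
    by_contra h
    push Not at h
    exact hKp (g.nondegenerate p _ h)
  have hdFp0 : mvfderiv I F p ≠ 0 := by
    intro h0
    have h := hdFp u₀
    rw [h0, zero_apply] at h
    exact mul_ne_zero hc hu₀ h.symm
  -- `dF_p(T p) = 0` gives `g(K p, T p) = 0`
  have hKperp : ∀ {v : TangentSpace I p}, mvfderiv I F p v = 0 → g.val p (K p) v = 0 := by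
    intro v hv
    have h := hdFp v
    rw [hv] at h
    exact (mul_eq_zero.mp h.symm).resolve_left hc
  -- (1) tangent extensions of `X` and `Z`
  obtain ⟨Xt, hXt, hXtp, hXtker⟩ := exists_tangent_extension_fun hFs hdFp0 hX
  obtain ⟨Zt, hZt, hZtp, hZtker⟩ := exists_tangent_extension_fun hFs hdFp0 hZ
  have hKs : CMDiffAt ∞ (T% K) p := hK.contMDiff p
  have hKd : MDiffAt (T% K) p := hK.mdifferentiableAt p
  have hXtd : MDiffAt (T% Xt) p := hXt.mdifferentiableAt (by simp)
  have hZtd : MDiffAt (T% Zt) p := hZt.mdifferentiableAt (by simp)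
  -- (2) `g(K, T)` vanishes on `{F = 0}` near `p` for `T` tangent; differentiate along `W p ∈ ker dF_p`
  have hstar : ∀ {T W : Π y : M, TangentSpace I y}, CMDiffAt ∞ (T% T) p →
      (∀ᶠ y in 𝓝 p, mvfderiv I F y (T y) = 0) → MDiffAt (T% W) p →
      mvfderiv I F p (W p) = 0 →
      g.val p (g.leviCivita K p (W p)) (T p) + g.val p (K p) (g.leviCivita T p (W p)) = 0 := by
    intro T W hT hTker hW hWker
    have hΨ1 : ContMDiffAt I 𝓘(ℝ, ℝ) ∞ (fun y ↦ g.val y (K y) (T y)) p :=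
      g.contMDiffAt_val_apply le_rfl hKs hT
    have hTp : g.val p (K p) (T p) = 0 := hKperp hTker.self_of_nhds
    have hzero : ∀ᶠ y in 𝓝 p, F y = F p → g.val y (K y) (T y) = g.val p (K p) (T p) := by
      filter_upwards [hdF, hTker] with y hy hTy hFy
      rw [hFp] at hFy
      obtain ⟨c', hc', hc'F⟩ := hy hFy
      have h := hc'F (T y)
      rw [hTy] at h
      rw [hTp]
      exact (mul_eq_zero.mp h.symm).resolve_left hc'
    have hdΨ : mvfderiv I (fun y ↦ g.val y (K y) (T y)) p (W p) = 0 :=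
      mvfderiv_apply_eq_zero_of_levelSet hF1 (hΨ1.of_le ENat.LEInfty.out) hzero hdFp0 hWker
    rw [hLC.2 hW hKd (hT.mdifferentiableAt (by simp))] at hdΨ
    exact hdΨ
  have hXp : mvfderiv I F p (Xt p) = 0 := by rw [hXtp]; exact hX
  have hZp : mvfderiv I F p (Zt p) = 0 := by rw [hZtp]; exact hZ
  have h1 := hstar hZt hZtker hXtd hXp
  have h2 := hstar hXt hXtker hZtd hZp
  rw [hXtp, hZtp] at h1 h2
  -- (3) the Hessian of `F` on the tangent extensions
  have hHess : ∀ {T W : Π y : M, TangentSpace I y}, MDiffAt (T% T) p → MDiffAt (T% W) p →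
      (∀ᶠ y in 𝓝 p, mvfderiv I F y (T y) = 0) →
      g.hessian F p (W p) (T p) = -(c * g.val p (K p) (g.leviCivita T p (W p))) := by
    intro T W hT hW hTker
    rw [PseudoRiemannianMetric.hessian_apply_holds (g := g) hF2 hW hT]
    have hev : (fun y ↦ mvfderiv I F y (T y)) =ᶠ[𝓝 p] fun _ ↦ (0 : ℝ) := hTker
    have h0 : mvfderiv I (fun y ↦ mvfderiv I F y (T y)) p = 0 := by
      rw [mvfderiv_congr_of_eventuallyEq hev]
      exact mvfderiv_const (0 : ℝ)
    simp only [PseudoRiemannianMetric.hessianAux]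
    rw [h0, zero_apply, zero_sub, hdFp]
  have h3 := hHess hZtd hXtd hZtker
  have h4 := hHess hXtd hZtd hXtker
  rw [hXtp, hZtp] at h3 h4
  have hsymm : g.hessian F p X Z = g.hessian F p Z X :=
    (PseudoRiemannianMetric.hessian_symm_holds (g := g) hF2).eq X Z
  rw [h3, h4] at hsymm
  have h5 : g.val p (K p) (g.leviCivita Zt p X) = g.val p (K p) (g.leviCivita Xt p Z) := by
    have := neg_injective hsymm
    exact mul_left_cancel₀ hc this
  -- (4) the Killing equation
  have hKill := hK.val_leviCivita_add p X Z
  rw [g.symm p X (g.leviCivita K p Z)] at hKill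
  linarith

end NHSecondFF

/-- **Registered sub-goal form of NH4** (closed statement over `E4`-charted manifolds, crux
stmt-FinalStateConjecture-17840): for a Killing field `K` and a smooth local defining function `F`
of a hypersurface through `p` on which `dF = c' g(K, ·)`, `c' ≠ 0`, the hypersurface is totally
geodesic along `K` at `p`: `g(∇_X K, Z) = 0` for all `X, Z ∈ ker dF_p`. -/
theorem stub_nh_secondFF : ∀ (M : Type) [TopologicalSpace M] [ChartedSpace E4 M] [IsManifold (𝓡 4) ∞ M] (g : PseudoRiemannianMetric (𝓡 4) ∞ E4 (TangentSpace (𝓡 4) : M → Type _)) [g.HasLeviCivita] (K : Π x : M, TangentSpace (𝓡 4) x) (F : M → ℝ) (p : M) (c : ℝ), g.IsKillingField K → (∀ᶠ x in 𝓝 p, ContMDiffAt (𝓡 4) 𝓘(ℝ, ℝ) ∞ F x) → F p = 0 → K p ≠ 0 → c ≠ 0 → (∀ w : TangentSpace (𝓡 4) p, mvfderiv (𝓡 4) F p w = c * g.val p (K p) w) → (∀ᶠ x in 𝓝 p, F x = 0 → ∃ c' : ℝ, c' ≠ 0 ∧ ∀ w : TangentSpace (𝓡 4) x, mvfderiv (𝓡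 4) F x w = c' * g.val x (K x) w) → ∀ X Z : TangentSpace (𝓡 4) p, mvfderiv (𝓡 4) F p X = 0 → mvfderiv (𝓡 4) F p Z = 0 → g.val p (g.leviCivita K p X) Z = 0 :=
  fun _ _ _ _ _ _ _ _ _ _ hK hF hFp hKp hc hdFp hdF _ _ hX hZ ↦
    nh_secondFF_eq_zero hK hF hFp hKp hc hdFp hdF hX hZ

end Summit.FinalStateConjecture.FinalStateConjecture.Theorems.HawkingExtensionIsKerr.SketchIdeator2

end
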